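import Mathlib
import Literature.Analysis.FluidPDE.Tao2016AveragedNS.ShiftSetCascadeFlows
import Literature.Analysis.FluidPDE.Tao2016AveragedNS.ShiftSetCascadeFlux
import Summits.NavierStokesRegularity.NavierStokesRegularity.Theorems.TaoLadderRungTwoFlatQuadPolarOn
import Summits.NavierStokesRegularity.NavierStokesRegularity.Theorems.TaoLadderRungTwoFlatLinearisedUniqueness
import Summits.NavierStokesRegularity.NavierStokesRegularity.Theorems.TaoLadderRungTwoFlatForcedGronwall
import Summits.NavierStokesRegularity.NavierStokesRegularity.Theorems.TaoLadderRungTwoFlatVariationalExistence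
import Summits.NavierStokesRegularity.NavierStokesRegularity.Theorems.TaoLadderRungTwoFlatHomogeneousL2Field
import Summits.NavierStokesRegularity.NavierStokesRegularity.Theorems.TaoLadderRungTwoFlatGaugeGronwall
import HarnessLib

/-!
# LINEAR ⇒ NONLINEAR HOP ESTIMATE in a gauge: linearisation error quadratic IN THE GAUGE, and the transfer of a
  linearised hop contraction (shape of (S2) `MirrorPulse.LinearisedHopContraction`) to the nonlinear deviation
  (helper for item stmt-NavierStokesRegularity-22987 `FlatGapCertificatesV2`, crux K_A♭ of route TaoLadderRungTwoFlat;
  cell harvest/h2-tao-ladder, p1 g20 — lemma L3 «linear ⇒ nonlinear validated hop» of the analytic lane,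
  LADDER §47.3 / TRANSFER-CONSTANTS §5, estimate part)

Scale ratio `1`, nearest-neighbour shift set `𝕊`, any table `α`, reference solution `W` and perturbed solution `X`,
both exact, global and bounded by `M`. Two gauges enter: an ADMISSIBLE window-regular gauge `w`
(`IsWindowAdmissible`: `w_{i,n} ≤ A·w_{j,k}·w_{j',k'}` across the window — the product rule that makes the quadratic
remainder small IN THE GAUGE, cf. `TaoCascade.WeightRatiosLEOn`; e.g. `w_k = max(1, g^k)`) and the contraction gauge
`ω` of the linear hypothesis, dominated by a shift of `w` (`ω_{i,k} ≤ Γ·w_{i,k+N}`; e.g. `ω_k = g^{k⁺}b^{−k⁻} ≤ w_{k+N}`):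

* `gauge_abs_bilinOn_le`, `gauge_abs_quadTermOn_le` — `w_{i,n}|Q(η)_{i,n}| ≤ ‖α‖₁ A c²` from window gauge bounds
  `w|η| ≤ c`;
* `lipschitz_time_of_globalSol` — a bounded exact solution is `‖α‖₁M²`-Lipschitz in time (for
  `…VariationalExistence.exists_linearised_solution`);
* `gauge_linearisation_error` — **`w|X − W − u|(s) ≤ ‖α‖₁ A (B̃ e^{L'T})² s e^{L's}`** on `[0, T]` for the variational
  solution `u` along `W` from `X(0) − W(0)`, `w|X(0) − W(0)| ≤ B̃`, `L' = 2‖α‖₁ M Λ`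
  (gauge Gronwall `…GaugeGronwall` twice: continuity in data, then the forced equation for the remainder);
* `nonlinear_hop_estimate` — **if every bounded variational solution `u` along `W` with `ω|u(0)| ≤ B` satisfies,
  read `N` shells up at time `T`, `ω_{i,k}|u_{i,k+N}(T) − c₁v₁ − c₂v₂| ≤ ρB` for some `|c₁|,|c₂| ≤ CB` (the shape of
  (S2)), then the NONLINEAR deviation obeys `ω_{i,k}|X_{i,k+N}(T) − W_{i,k+N}(T) − c₁v₁ − c₂v₂| ≤ ρB + Γ‖α‖₁A(B̃e^{L'T})²Te^{L'T}`**
  whenever `ω|X(0) − W(0)| ≤ B` and `w|X(0) − W(0)| ≤ B̃`: a linear contraction modulo the neutral directions becomes a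
  nonlinear quasi-contraction with a remainder quadratic in the admissible gauge — the basin statement of L3.

HONEST FRAMING: elementary perturbation theory for MODEL lattices (Tao 2016 §4 vocabulary, shift-set parametrised); no
pulse is constructed, nothing is certified, nothing here is a statement about the Navier–Stokes equations.
-/

noncomputable section

-- the sub-problem namespace repeats the summit name by design (D-0017)
set_option linter.dupNamespace false

namespace Summit.NavierStokesRegularity.NavierStokesRegularity.Theorems

open Set Filter Literature.Analysis.FluidPDE Literature.Analysis.FluidPDE.TaoCascade
open scoped Topology Nat

namespace QuadPolar

variable {m : ℕ}

/-! ### Admissible gauges and the quadratic term -/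

/-- A gauge is **window-admissible with constant `A ≥ 0`** when `w_{i,n} ≤ A·w_{j,k}·w_{j',k'}` for all species and
all `k, k' ∈ {n−1, n, n+1}`: the weight of the output of a nearest-neighbour triad is dominated by the product of the
weights of its two inputs (gauge analogue of `TaoCascade.WeightRatiosLEOn` at scale ratio `1`). [folklore] -/
def IsWindowAdmissible (w : Fin m → ℤ → ℝ) (A : ℝ) : Prop :=
  0 ≤ A ∧ ∀ (i j j' : Fin m) (n k k' : ℤ), n - 1 ≤ k ∧ k ≤ n + 1 → n - 1 ≤ k' ∧ k' ≤ n + 1 →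
    w i n ≤ A * w j k * w j' k'

/-- **The polarisation in an admissible gauge**: window gauge bounds `w|X| ≤ c_X`, `w|Y| ≤ c_Y` at time `t` give
`w_{i,n}|B(X,Y)_{i,n}(t)| ≤ ‖α‖₁ A c_X c_Y`. [cite: Tao2016AveragedNS, §4 (4.8); folklore estimate] -/
theorem gauge_abs_bilinOn_le {𝕊 : Finset (ℤ × ℤ × ℤ)} (h𝕊 : IsNearestNeighbourSet 𝕊)
    (α : Fin m → Fin m → Fin m → ℤ × ℤ × ℤ → ℝ) {w : Fin m → ℤ → ℝ} {A : ℝ} (hwpos : ∀ i n, 0 < w i n)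
    (hA : IsWindowAdmissible w A) {X Y : Fin m → ℤ → ℝ → ℝ} {cX cY : ℝ} {t : ℝ} (hcX : 0 ≤ cX) (hcY : 0 ≤ cY)
    {i : Fin m} {n : ℤ} (hX : ∀ j k, n - 1 ≤ k ∧ k ≤ n + 1 → w j k * |X j k t| ≤ cX)
    (hY : ∀ j k, n - 1 ≤ k ∧ k ≤ n + 1 → w j k * |Y j k t| ≤ cY) :
    w i n * |bilinOn 𝕊 0 α X Y i n t| ≤ tableAbsSum 𝕊 α * A * cX * cY := by
  classical
  have hwin : 0 < w i n := hwpos i n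
  unfold bilinOn
  rw [← abs_of_pos hwin, ← abs_mul, Finset.mul_sum]
  simp_rw [Finset.mul_sum]
  have hterm : ∀ (i₁ i₂ : Fin m) (μ : ℤ × ℤ × ℤ), μ ∈ 𝕊 →
      |w i n * (α i₁ i₂ i μ * (1 + (0 : ℝ)) ^ ((5 : ℝ) * (n - μ.2.2) / 2) *
          (X i₁ (n - μ.2.2 + μ.1) t * Y i₂ (n - μ.2.2 + μ.2.1) t))| ≤ |α i₁ i₂ i μ| * (A * cX * cY) := by
    intro i₁ i₂ μ hμ
    obtain ⟨h1, h2, h3⟩ := h𝕊 μ hμ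
    have hk1 : n - 1 ≤ n - μ.2.2 + μ.1 ∧ n - μ.2.2 + μ.1 ≤ n + 1 := by omega
    have hk2 : n - 1 ≤ n - μ.2.2 + μ.2.1 ∧ n - μ.2.2 + μ.2.1 ≤ n + 1 := by omega
    have hw1 : 0 < w i₁ (n - μ.2.2 + μ.1) := hwpos _ _
    have hw2 : 0 < w i₂ (n - μ.2.2 + μ.2.1) := hwpos _ _
    have hx := hX i₁ _ hk1
    have hy := hY i₂ _ hk2
    have hadm := hA.2 i i₁ i₂ n _ _ hk1 hk2
    rw [add_zero, Real.one_rpow, mul_one]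
    have e : w i n * (α i₁ i₂ i μ * (X i₁ (n - μ.2.2 + μ.1) t * Y i₂ (n - μ.2.2 + μ.2.1) t)) =
        α i₁ i₂ i μ * (w i n / (w i₁ (n - μ.2.2 + μ.1) * w i₂ (n - μ.2.2 + μ.2.1))) *
          ((w i₁ (n - μ.2.2 + μ.1) * X i₁ (n - μ.2.2 + μ.1) t) * (w i₂ (n - μ.2.2 + μ.2.1) * Y i₂ (n - μ.2.2 + μ.2.1) t)) := by
      field_simp
    rw [e, abs_mul, abs_mul, abs_mul, abs_mul, abs_mul, abs_of_pos hw1, abs_of_pos hw2]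
    have hratio : |w i n / (w i₁ (n - μ.2.2 + μ.1) * w i₂ (n - μ.2.2 + μ.2.1))| ≤ A := by
      rw [abs_of_pos (div_pos hwin (mul_pos hw1 hw2)), div_le_iff₀ (mul_pos hw1 hw2)]
      linarith [hadm]
    have hA0 : 0 ≤ A := hA.1
    calc |α i₁ i₂ i μ| * |w i n / (w i₁ (n - μ.2.2 + μ.1) * w i₂ (n - μ.2.2 + μ.2.1))| *
          (w i₁ (n - μ.2.2 + μ.1) * |X i₁ (n - μ.2.2 + μ.1) t| * (w i₂ (n - μ.2.2 + μ.2.1) * |Y i₂ (n - μ.2.2 + μ.2.1) t|))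
        ≤ |α i₁ i₂ i μ| * A * (cX * cY) := by
          have h0 : 0 ≤ w i₁ (n - μ.2.2 + μ.1) * |X i₁ (n - μ.2.2 + μ.1) t| := by positivity
          exact mul_le_mul (mul_le_mul_of_nonneg_left hratio (abs_nonneg _)) (mul_le_mul hx hy (by positivity) hcX)
            (by positivity) (by positivity)
      _ = |α i₁ i₂ i μ| * (A * cX * cY) := by ring
  calc |∑ i₁, ∑ i₂, ∑ μ ∈ 𝕊, w i n * (α i₁ i₂ i μ * (1 + (0 : ℝ)) ^ ((5 : ℝ) * (n - μ.2.2) / 2) *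
          (X i₁ (n - μ.2.2 + μ.1) t * Y i₂ (n - μ.2.2 + μ.2.1) t))|
      ≤ ∑ i₁, ∑ i₂, ∑ μ ∈ 𝕊, |α i₁ i₂ i μ| * (A * cX * cY) := by
        refine (Finset.abs_sum_le_sum_abs _ _).trans (Finset.sum_le_sum fun i₁ _ => ?_)
        refine (Finset.abs_sum_le_sum_abs _ _).trans (Finset.sum_le_sum fun i₂ _ => ?_)
        exact (Finset.abs_sum_le_sum_abs _ _).trans (Finset.sum_le_sum fun μ hμ => hterm i₁ i₂ μ hμ)
    _ = (∑ i₁, ∑ i₂, ∑ μ ∈ 𝕊, |α i₁ i₂ i μ|) * (A * cX * cY) := by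
        simp only [← Finset.sum_mul]
    _ ≤ tableAbsSum 𝕊 α * (A * cX * cY) := by
        have hle : (∑ i₁, ∑ i₂, ∑ μ ∈ 𝕊, |α i₁ i₂ i μ|) ≤ tableAbsSum 𝕊 α := by
          unfold tableAbsSum
          exact Finset.single_le_sum (f := fun i => ∑ i₁, ∑ i₂, ∑ μ ∈ 𝕊, |α i₁ i₂ i μ|)
            (fun _ _ => by positivity) (Finset.mem_univ i)
        have : 0 ≤ A * cX * cY := by have := hA.1; positivity
        exact mul_le_mul_of_nonneg_right hle this
    _ = tableAbsSum 𝕊 α * A * cX * cY := by ring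

/-- **The quadratic term in an admissible gauge**: `w|η| ≤ c` on the window of `n` at time `t` gives
`w_{i,n}|Q(η)_{i,n}(t)| ≤ ‖α‖₁ A c²`. [cite: Tao2016AveragedNS, §4 (4.8); folklore estimate] -/
theorem gauge_abs_quadTermOn_le {𝕊 : Finset (ℤ × ℤ × ℤ)} (h𝕊 : IsNearestNeighbourSet 𝕊)
    (α : Fin m → Fin m → Fin m → ℤ × ℤ × ℤ → ℝ) {w : Fin m → ℤ → ℝ} {A : ℝ} (hwpos : ∀ i n, 0 < w i n)
    (hA : IsWindowAdmissible w A) {η : Fin m → ℤ → ℝ → ℝ} {c : ℝ} {t : ℝ} (hc : 0 ≤ c) {i : Fin m} {n : ℤ}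
    (hη : ∀ j k, n - 1 ≤ k ∧ k ≤ n + 1 → w j k * |η j k t| ≤ c) :
    w i n * |quadTermOn 𝕊 0 α η i n t| ≤ tableAbsSum 𝕊 α * A * c ^ 2 := by
  rw [quadTermOn_eq_bilinOn, sq, ← mul_assoc]
  exact gauge_abs_bilinOn_le h𝕊 α hwpos hA hc hc hη hη

/-! ### Linearisation error in the gauge -/

/-- A bounded exact global solution at scale ratio `1` is `‖α‖₁M²`-Lipschitz in time at every site (mean value
inequality with `|Ẋ| = |Q(X)| ≤ ‖α‖₁ M²`). [cite: Tao2016AveragedNS, §4 (4.8); folklore] -/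
theorem lipschitz_time_of_globalSol (𝕊 : Finset (ℤ × ℤ × ℤ)) (α : Fin m → Fin m → Fin m → ℤ × ℤ × ℤ → ℝ)
    {X : Fin m → ℤ → ℝ → ℝ} {M : ℝ} (hX : ∀ i n t, HasDerivAt (X i n) (quadTermOn 𝕊 0 α X i n t) t)
    (hM : ∀ j k t, |X j k t| ≤ M) (j : Fin m) (k : ℤ) (t s : ℝ) :
    |X j k t - X j k s| ≤ tableAbsSum 𝕊 α * M ^ 2 * |t - s| := by
  have hbound : ∀ x ∈ (univ : Set ℝ), ‖quadTermOn 𝕊 0 α X j k x‖ ≤ tableAbsSum 𝕊 α * M ^ 2 := by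
    intro x _
    rw [Real.norm_eq_abs]
    exact abs_quadTermOn_zero_le_tableAbsSum 𝕊 α (fun j' k' => hM j' k' x) j k
  have h := Convex.norm_image_sub_le_of_norm_hasDerivWithin_le (f := X j k) (s := univ)
    (fun x _ => (hX j k x).hasDerivWithinAt) hbound convex_univ (mem_univ s) (mem_univ t)
  simpa [Real.norm_eq_abs] using h

/-- **GAUGE LINEARISATION ERROR**: `W`, `X` exact global solutions bounded by `M`; `w` a window-regular (`Λ`) and
window-admissible (`A`) gauge; `w|X(0) − W(0)| ≤ B̃`; `u` the variational solution along `W` from `X(0) − W(0)`,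
sup-bounded on `[0, T]`. Then on `[0, T]`, with `L' = 2‖α‖₁ M Λ`,
`w_{i,n}|X_{i,n}(s) − W_{i,n}(s) − u_{i,n}(s)| ≤ ‖α‖₁ A (B̃ e^{L'T})² s e^{L's}` — the remainder is quadratic IN THE GAUGE.
[cite: Tao2016AveragedNS, §4 (4.8); folklore (Duhamel–Gronwall)] -/
theorem gauge_linearisation_error {𝕊 : Finset (ℤ × ℤ × ℤ)} (h𝕊 : IsNearestNeighbourSet 𝕊)
    (α : Fin m → Fin m → Fin m → ℤ × ℤ × ℤ → ℝ) {w : Fin m → ℤ → ℝ} {Λ A : ℝ} (hw : IsWindowRegular w Λ)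
    (hA : IsWindowAdmissible w A) {W X u : Fin m → ℤ → ℝ → ℝ} {M Mu B T : ℝ}
    (hW : ∀ i n t, HasDerivAt (W i n) (quadTermOn 𝕊 0 α W i n t) t)
    (hX : ∀ i n t, HasDerivAt (X i n) (quadTermOn 𝕊 0 α X i n t) t)
    (hWb : ∀ i n t, |W i n t| ≤ M) (hXb : ∀ i n t, |X i n t| ≤ M)
    (hu : ∀ i n t, HasDerivAt (u i n) (linTermOn 𝕊 0 α W u i n t) t)
    (hub : ∀ i n, ∀ t ∈ Icc 0 T, |u i n t| ≤ Mu) (hu0 : ∀ i n, u i n 0 = X i n 0 - W i n 0)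
    (hB : ∀ i n, w i n * |X i n 0 - W i n 0| ≤ B) (i : Fin m) (n : ℤ) {s : ℝ} (hs : s ∈ Icc 0 T) :
    w i n * |X i n s - W i n s - u i n s| ≤
      tableAbsSum 𝕊 α * A * (B * Real.exp (2 * tableAbsSum 𝕊 α * M * Λ * T)) ^ 2 * s *
        Real.exp (2 * tableAbsSum 𝕊 α * M * Λ * s) := by
  set η : Fin m → ℤ → ℝ → ℝ := X - W with hη
  set ζ : Fin m → ℤ → ℝ → ℝ := fun j k t => η j k t - u j k t with hζ
  set f : Fin m → ℤ → ℝ → ℝ := fun j k t => quadTermOn 𝕊 0 α η j k t with hf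
  set R : ℝ := B * Real.exp (2 * tableAbsSum 𝕊 α * M * Λ * T) with hR
  have hwpos := hw.1
  have hXc : ∀ j k, Continuous (X j k) := fun j k => continuous_iff_continuousAt.2 fun t => (hX j k t).continuousAt
  have hWc : ∀ j k, Continuous (W j k) := fun j k => continuous_iff_continuousAt.2 fun t => (hW j k t).continuousAt
  have hηc : ∀ j k, Continuous (η j k) := fun j k => by
    have hc : Continuous fun t => X j k t - W j k t := (hXc j k).sub (hWc j k)
    exact hc
  have hM : 0 ≤ M := (abs_nonneg _).trans (hWb i n 0)
  have hΛ : 0 ≤ Λ := le_trans zero_le_one hw.2.1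
  have hB0 : 0 ≤ B := le_trans (mul_nonneg (hwpos i n).le (abs_nonneg _)) (hB i n)
  have hR0 : 0 ≤ R := by rw [hR]; positivity
  -- gauge a priori bound on the deviation on [0, T] (gauge continuity in the data)
  have hηb : ∀ j k, ∀ t ∈ Icc 0 T, w j k * |η j k t| ≤ R := by
    intro j k t ht
    have h := gauge_abs_sub_le h𝕊 α hw hX hW hXb hWb hB j k ht.1
    have hA' := tableAbsSum_nonneg 𝕊 α
    have hmono : Real.exp (2 * tableAbsSum 𝕊 α * M * Λ * t) ≤ Real.exp (2 * tableAbsSum 𝕊 α * M * Λ * T) :=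
      Real.exp_le_exp.mpr (mul_le_mul_of_nonneg_left ht.2 (by positivity))
    calc w j k * |η j k t| = w j k * |X j k t - W j k t| := rfl
      _ ≤ B * Real.exp (2 * tableAbsSum 𝕊 α * M * Λ * t) := h
      _ ≤ R := by rw [hR]; exact mul_le_mul_of_nonneg_left hmono hB0
  -- the forcing f = Q(η): continuous, gauge-bounded by ‖α‖₁ A R² on [0, T]
  have hfc : ∀ j k, Continuous (f j k) := fun j k => by
    simp only [hf, quadTermOn]
    refine continuous_finsetSum _ fun i₁ _ => continuous_finsetSum _ fun i₂ _ =>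
      continuous_finsetSum _ fun μ _ => ?_
    exact continuous_const.mul ((hηc _ _).mul (hηc _ _))
  have hfb : ∀ j k, ∀ t ∈ Icc 0 T, w j k * |f j k t| ≤ tableAbsSum 𝕊 α * A * R ^ 2 := fun j k t ht =>
    gauge_abs_quadTermOn_le h𝕊 α hwpos hA hR0 fun j' k' _ => hηb j' k' t ht
  have hF : 0 ≤ tableAbsSum 𝕊 α * A * R ^ 2 := by have := tableAbsSum_nonneg 𝕊 α; have := hA.1; positivity
  -- ζ solves the forced linearised equation along W with forcing f, zero data
  have hder : ∀ j k t, HasDerivAt (ζ j k) (linTermOn 𝕊 0 α W ζ j k t + f j k t) t := by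
    intro j k t
    have e1 : quadTermOn 𝕊 0 α X j k t - quadTermOn 𝕊 0 α W j k t =
        linTermOn 𝕊 0 α W η j k t + quadTermOn 𝕊 0 α η j k t := by
      have hXe : X = W + η := by funext a b c; simp [hη]
      rw [hXe, quadTermOn_add_eq_lin]; ring
    have e2 : linTermOn 𝕊 0 α W ζ j k t = linTermOn 𝕊 0 α W η j k t - linTermOn 𝕊 0 α W u j k t := by
      have hζe : ζ = η + (-1 : ℝ) • u := by funext a b c; simp [hζ]; ring
      rw [hζe, linTermOn_add, linTermOn_smul]; ring
    have hd : HasDerivAt (ζ j k) ((quadTermOn 𝕊 0 α X j k t - quadTermOn 𝕊 0 α W j k t) -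
        linTermOn 𝕊 0 α W u j k t) t := ((hX j k t).sub (hW j k t)).sub (hu j k t)
    refine hd.congr_deriv ?_
    rw [e1, e2, hf]
    ring
  have hζb : ∀ j k, ∀ t ∈ Icc 0 T, |ζ j k t| ≤ 2 * M + Mu := fun j k t ht => by
    have h1 : |η j k t| ≤ 2 * M := by
      show |X j k t - W j k t| ≤ 2 * M
      linarith [abs_sub (X j k t) (W j k t), hXb j k t, hWb j k t]
    exact (abs_sub _ _).trans (add_le_add h1 (hub j k t ht))
  have hζ0 : ∀ j k, w j k * |ζ j k 0| ≤ 0 := fun j k => by simp [hζ, hη, hu0 j k]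
  have h := gauge_abs_le_forced_exp h𝕊 α hw hWc hWb hfc hfb hF hder hζb hζ0 i n hs
  rw [zero_add] at h
  calc w i n * |X i n s - W i n s - u i n s| = w i n * |ζ i n s| := rfl
    _ ≤ tableAbsSum 𝕊 α * A * R ^ 2 * s * Real.exp (2 * tableAbsSum 𝕊 α * M * Λ * s) := h

/-! ### Linear ⇒ nonlinear hop estimate -/

/-- **LINEAR ⇒ NONLINEAR HOP ESTIMATE.** Scale ratio `1`, nearest-neighbour `𝕊`, exact global solutions `W`
(reference) and `X`, both bounded by `M`; `w` a window-regular (`Λ`), window-admissible (`A`) gauge and `ω ≥ 0` a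
second gauge with `ω_{i,k} ≤ Γ·w_{i,k+N}`. HYPOTHESIS (shape of (S2) `LinearisedHopContraction`, along `W`, horizon
`T`, hop `N`, directions `v₁, v₂`): every variational solution `u` along `W`, sup-bounded on `[0, T]`, with
`ω|u(0)| ≤ B` admits `|c₁|, |c₂| ≤ CB` with `ω_{i,k}|u_{i,k+N}(T) − c₁v₁_{i,k} − c₂v₂_{i,k}| ≤ ρB`. CONCLUSION: if
`ω|X(0) − W(0)| ≤ B` and `w|X(0) − W(0)| ≤ B̃` then for some `|c₁|, |c₂| ≤ CB`,
`ω_{i,k}|X_{i,k+N}(T) − W_{i,k+N}(T) − c₁v₁_{i,k} − c₂v₂_{i,k}| ≤ ρB + Γ‖α‖₁A(B̃e^{L'T})²Te^{L'T}`, `L' = 2‖α‖₁MΛ`.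
[cite: Tao2016AveragedNS, §4 (4.8) and §6.3–6.4 (statement shape); route TaoLadderRungTwoFlat, analytic lane L3 (estimate part)] -/
theorem nonlinear_hop_estimate {𝕊 : Finset (ℤ × ℤ × ℤ)} (h𝕊 : IsNearestNeighbourSet 𝕊)
    (α : Fin m → Fin m → Fin m → ℤ × ℤ × ℤ → ℝ) {w ω : Fin m → ℤ → ℝ} {Λ A Γ : ℝ} (hw : IsWindowRegular w Λ)
    (hA : IsWindowAdmissible w A) (hω : ∀ i k, 0 ≤ ω i k) {N : ℤ} (hΓ : ∀ i k, ω i k ≤ Γ * w i (k + N))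
    {W X : Fin m → ℤ → ℝ → ℝ} {v₁ v₂ : Fin m → ℤ → ℝ} {M T ρ C B B' : ℝ} (hT : 0 ≤ T)
    (hW : ∀ i n t, HasDerivAt (W i n) (quadTermOn 𝕊 0 α W i n t) t)
    (hX : ∀ i n t, HasDerivAt (X i n) (quadTermOn 𝕊 0 α X i n t) t)
    (hWb : ∀ i n t, |W i n t| ≤ M) (hXb : ∀ i n t, |X i n t| ≤ M)
    (hlin : ∀ u : Fin m → ℤ → ℝ → ℝ, (∀ i n t, HasDerivAt (u i n) (linTermOn 𝕊 0 α W u i n t) t) →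
      (∃ Mu : ℝ, ∀ i n, ∀ t ∈ Icc 0 T, |u i n t| ≤ Mu) → (∀ i k, ω i k * |u i k 0| ≤ B) →
        ∃ c₁ c₂ : ℝ, |c₁| ≤ C * B ∧ |c₂| ≤ C * B ∧
          ∀ i k, ω i k * |u i (k + N) T - c₁ * v₁ i k - c₂ * v₂ i k| ≤ ρ * B)
    (hB : ∀ i k, ω i k * |X i k 0 - W i k 0| ≤ B) (hB' : ∀ i k, w i k * |X i k 0 - W i k 0| ≤ B') :
    ∃ c₁ c₂ : ℝ, |c₁| ≤ C * B ∧ |c₂| ≤ C * B ∧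
      ∀ i k, ω i k * |X i (k + N) T - W i (k + N) T - c₁ * v₁ i k - c₂ * v₂ i k| ≤
        ρ * B + Γ * (tableAbsSum 𝕊 α * A * (B' * Real.exp (2 * tableAbsSum 𝕊 α * M * Λ * T)) ^ 2 * T *
          Real.exp (2 * tableAbsSum 𝕊 α * M * Λ * T)) := by
  have hM0 : 0 ≤ max M 0 := le_max_right _ _
  have hWb' : ∀ j k t, |W j k t| ≤ max M 0 := fun j k t => (hWb j k t).trans (le_max_left _ _)
  have hlipW : ∀ j k t s, |W j k t - W j k s| ≤ tableAbsSum 𝕊 α * (max M 0) ^ 2 * |t - s| :=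
    lipschitz_time_of_globalSol 𝕊 α hW hWb'
  have hΛt : 0 ≤ tableAbsSum 𝕊 α * (max M 0) ^ 2 := by have := tableAbsSum_nonneg 𝕊 α; positivity
  have hd0 : ∀ i k, |(fun i k => X i k 0 - W i k 0) i k| ≤ 2 * max M 0 := by
    intro i k
    have h1 := hXb i k 0
    have h2 := hWb i k 0
    have h3 := le_max_left M 0
    calc |X i k 0 - W i k 0| ≤ |X i k 0| + |W i k 0| := abs_sub _ _
      _ ≤ 2 * max M 0 := by linarith
  -- the variational solution along W from the initial deviation (global, sup-bounded on compact intervals)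
  obtain ⟨u, hu0, hud, hub⟩ := exists_linearised_solution 𝕊 α hWb' hM0 hΛt hlipW hd0
  have hubT : ∀ i n, ∀ t ∈ Icc 0 T,
      |u i n t| ≤ 2 * max M 0 * Real.exp (2 * tableAbsSum 𝕊 α * max M 0 * T) :=
    fun i n t ht => hub T hT i n t ⟨by linarith [ht.1], ht.2⟩
  -- the linear hypothesis applied to u
  obtain ⟨c₁, c₂, hc₁, hc₂, hlinu⟩ := hlin u hud ⟨_, hubT⟩ (fun i k => by rw [hu0]; exact hB i k)
  refine ⟨c₁, c₂, hc₁, hc₂, fun i k => ?_⟩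
  have hu0' : ∀ i n, u i n 0 = X i n 0 - W i n 0 := fun i n => hu0 i n
  -- the gauge linearisation error at the read-out site
  have herr := gauge_linearisation_error h𝕊 α hw hA hW hX hWb hXb hud hubT hu0' hB' i (k + N) ⟨hT, le_rfl⟩
  have hwpos : 0 < w i (k + N) := hw.1 i (k + N)
  have hΓ0 : 0 ≤ Γ := by
    have h := (hω i k).trans (hΓ i k)
    by_contra hneg
    push Not at hneg
    have : Γ * w i (k + N) < 0 := mul_neg_of_neg_of_pos hneg hwpos
    linarith
  have htri : |X i (k + N) T - W i (k + N) T - c₁ * v₁ i k - c₂ * v₂ i k| ≤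
      |u i (k + N) T - c₁ * v₁ i k - c₂ * v₂ i k| + |X i (k + N) T - W i (k + N) T - u i (k + N) T| := by
    have e : X i (k + N) T - W i (k + N) T - c₁ * v₁ i k - c₂ * v₂ i k =
        (u i (k + N) T - c₁ * v₁ i k - c₂ * v₂ i k) + (X i (k + N) T - W i (k + N) T - u i (k + N) T) := by ring
    rw [e]; exact abs_add_le _ _
  have h2 : ω i k * |X i (k + N) T - W i (k + N) T - u i (k + N) T| ≤
      Γ * (tableAbsSum 𝕊 α * A * (B' * Real.exp (2 * tableAbsSum 𝕊 α * M * Λ * T)) ^ 2 * T *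
        Real.exp (2 * tableAbsSum 𝕊 α * M * Λ * T)) := by
    calc ω i k * |X i (k + N) T - W i (k + N) T - u i (k + N) T|
        ≤ Γ * w i (k + N) * |X i (k + N) T - W i (k + N) T - u i (k + N) T| :=
          mul_le_mul_of_nonneg_right (hΓ i k) (abs_nonneg _)
      _ = Γ * (w i (k + N) * |X i (k + N) T - W i (k + N) T - u i (k + N) T|) := by ring
      _ ≤ _ := mul_le_mul_of_nonneg_left herr hΓ0
  calc ω i k * |X i (k + N) T - W i (k + N) T - c₁ * v₁ i k - c₂ * v₂ i k|
      ≤ ω i k * (|u i (k + N) T - c₁ * v₁ i k - c₂ * v₂ i k| +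
          |X i (k + N) T - W i (k + N) T - u i (k + N) T|) := mul_le_mul_of_nonneg_left htri (hω i k)
    _ = ω i k * |u i (k + N) T - c₁ * v₁ i k - c₂ * v₂ i k| +
          ω i k * |X i (k + N) T - W i (k + N) T - u i (k + N) T| := by ring
    _ ≤ _ := add_le_add (hlinu i k) h2

end QuadPolar

end Summit.NavierStokesRegularity.NavierStokesRegularity.Theorems

end
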